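import Summits.QuantumFields.YangMills.Theorems.BalabanUVNodesN19AffinityClassIndexLaws
import Literature.Dynamics.Contraction.ComplexConeContractionLemma22
import Mathlib.Analysis.SpecialFunctions.Log.Deriv
import Mathlib.Algebra.Order.BigOperators.Ring.Finset
import Mathlib.Algebra.BigOperators.Field

/-!
# BalabanUVNodes ∕ node N20 (NE7b) — THE HELLINGER ROAD'S ENDPOINT KERNEL, PART 1 (two laws on a finite class set): the COUPLING LEMMA, the MOMENT BOOTSTRAP and
# the range-free (Padé) V-SIDE with a wild∕tame split — every letter a statement about the two ONE-RUN laws `p, q`, the affinity spelled out `Σ_T √(p·q)`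

Cell `pub-ymgap` (HUMAN RULING D-0062 Track A ∕ director-ym R399 (3a) second-wave width seats), WIDTH SEAT `pub-ymgap-dag-n20-w5` (node n20 = NE7b),
generation g3, CLAIM-1 ∕ INTENT-1 (bus 2026-08-28T08:01:44Z), FILE 1a of 3 (INTENT-1 split for the 400-line rule into 1a = this file, §1–§2 + toy, and
1b = `…N20HellingerEndpointClassWeights`, §3–§4).  Key item K3⁷ `SpineGivenEndpointR13SepCoPH` (stmt-QuantumFields-20544; skeleton of record v5 941dddb108cbaacf,
stub 2 `stub_expansion13H` — faces `KeyedRelWeight` (N20), `KeyedShellWeight` (N21), `KeyedCoreEdgeHolderD4` (N19′) at the reading pinned by `PinnedAtLive`);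
filed `--kind proof --supports … --as helper`.  COUNT-NEUTRAL.  THEOREMS ONLY (0 `def`, 0 `instance`, 0 `notation`, 0 `sorry`).  ADDITIVE — imports dag-n19-w2 g5's
`…N19AffinityClassIndexLaws` (p612301: `affinity_le_one`, `sum_sq_sqrt_sub_sqrt_eq` BY NAME) and `Literature.Dynamics.Contraction.ComplexConeContractionLemma22`
(the tree's Padé bound `two_mul_sub_one_div_add_one_le_log` BY NAME — gate `dedup.landed` pointer) + Mathlib; modifies nothing.

WHY.  ym-nodeO idea-3's crux card `Ideas/hellinger-free-energy-road.md` EDITION 2 (g11, 2026-08-28T07:18Z) and CRIT-1's triage of it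
(`Cruxes/SpineGivenEndpointR13SepCoPH/CRIT-1-TRIAGE-hellinger-free-energy-road-ed2.md`, g5, 07:49Z: «SURVIVES priced — NEW-COMBINATION»; its §2 re-derives the
constants below independently; Rec. (e) «a width∕coupling seat may lift `abs_sum_sub_sum_le_hellinger` + `response_split` as helpers») move the road's
load-bearing letters OFF the interpolated class ensemble `μ_s ∝ A^{1−s}B^s` (CRIT-1 ed.1 §5: a two-run object) onto the two ENDPOINT laws.  The kernel of that
move is idea-3's `HellingerRoadSketch.lean` §10 — a `Cruxes/` workfile, farm-checked but NOT importable from `Theorems/`.  Files 1a∕1b RE-PROVE §10 (and the two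
lines of §3 it rests on) in SPELLED-OUT letters (no `bc`∕`l1` definitions) so that node N20's consumer lineage (dag-n20-w4's p609004 ∕ p612607, dag-n14-w2's
MGF road) can cite each letter BY NAME; FILE 2 `…N20HellingerEndpointRoad` composes them along `K` with p609004.  THIS FILE (two laws `p, q ≥ 0`, `Σp = Σq = 1`):
* §1 ★★ `abs_mean_sub_mean_le_hellinger` — the COUPLING LEMMA (Hellinger testing inequality) `|Σ q·f − Σ p·f| ≤ 2·√(2(1 − Σ√(pq)))·√(Σ ½(p+q)(f − c)²)` for ANY
  observable `f` and ANY centring `c` (Cauchy–Schwarz on `p − q = (√p − √q)(√p + √q)`, `(√p + √q)² ≤ 2(p + q)`); `sum_mul_sq_sub_eq` (bias–variance);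
  ★★ `mixtureMoment_le` — the MOMENT BOOTSTRAP: for a centring between the two means, `M ≤ ½(Var_p f + Var_q f) + 8(1 − Σ√(pq))·M`, `M = Σ ½(p+q)(f − c)²`;
  ★ `mixtureMoment_le_of_regime` — in the regime `1 − Σ√(pq) ≤ 1∕16`, `M ≤ Var_p f + Var_q f` (two ONE-RUN variances; the regime is an a-priori INPUT, displayed —
  dag-n20-w4 g2, bus 07:54Z (i): it cannot be dropped).
* §2 `sub_div_add_le_half_log` (from the tree's `[1,1]`-Padé bound `2(s−1)∕(s+1) ≤ log s`, `Literature.Dynamics.Contraction.two_mul_sub_one_div_add_one_le_log`),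
  `sub_sq_div_add_le_mul_log_sq` (`(a−b)²∕(a+b) ≤ ¼(a+b)(log a − log b)²` — UNIVERSAL constant, no range `e^{2R}`), `sq_sqrt_sub_sqrt_le`,
  ★ `one_sub_affinity_le_wildMass_add_triangular`, ★★ `one_sub_affinity_le_wildMass_add_logMoment`
  (`1 − Σ√(pq) ≤ ½·Σ_W(p+q) + ⅛·Σ_{T∖W}(p+q)(log p − log q)²` for ANY wild set `W ⊆ T`: wild classes cost their MASS, tame classes a mixture second moment).
* §3 toy (A6): identical laws — affinity `1`, the coupling bound is `0` and attained.
CREDIT.  Statements and proof routes follow idea-3 g11's Sketch §10∕§3 (`YMNodeOIdeate.Idea3.HellingerRoad.*`, Cruxes workfile f773383e26c5ac70) — re-proved, not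
imported; dag-n19-w2 g5's `…N19AffinityClassIndexLaws` (p612301) holds the Le Cam letters for laws and is CONSUMED BY NAME (`affinity_le_one`,
`sum_sq_sqrt_sub_sqrt_eq`); dag-n20-w1 g5's caricature files and dag-n20-w4 g2's interpolated road are disjoint.

HONEST FRAMING.  [folklore] finite-sum real analysis (Cauchy–Schwarz, a Padé bound) on hypothesis SHAPES; every letter (laws, observables, wild sets, the regime)
is a HYPOTHESIS produced by nobody — the two-run content of the road ((YG), (R′)) is NOT PRINTED for d = 4 and NOT asserted; NO estimate of Bałaban's programme is
proved; nothing of Bałaban's asserted or instantiated (no `Provisos₁₃CoPH` tuple — K0⁷ OPEN); NE7 ∕ NE7b ∕ NE7c NOT PRINTED as two-run statements for d = 4 and NOT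
proved; N19 ∕ N20 ∕ N21 NOT discharged; K3⁷ OPEN, v5 STANDS, not claimed; no summit statement is proved by this seat; counts UNMOVED (typed 28∕28 · discharged
5∕27, A 5∕28).  One finite four-torus programme at fixed ε — NOT ℝ⁴, NOT infinite volume, NOT OS, NOT a mass gap, NOT the Clay problem (R4 closes the conditional
finite-𝕋⁴ rung `BalabanLadder.UV` only).  0 `def`; 0 `sorry`; standard axioms; no cite tags.
-/

noncomputable section

namespace Summit.QuantumFields.YangMills.BalabanUVNodes.N20HellingerEndpointKernel

open Finset
open Summit.QuantumFields.YangMills.BalabanUVNodes.N19AffinityClassIndexLaws (affinity_le_one sum_sq_sqrt_sub_sqrt_eq)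
open Literature.Dynamics.Contraction (two_mul_sub_one_div_add_one_le_log)

variable {ι : Type*}

/-! ## §1 Two laws on a finite class set: the coupling lemma and the moment bootstrap [folklore] -/

section Laws
variable {T : Finset ι} {p q : ι → ℝ}

/-- Cauchy–Schwarz with an absolute value [folklore]: `|Σ_T a·b| ≤ √(Σ_T a²)·√(Σ_T b²)`. -/
theorem abs_sum_mul_le_sqrt_mul_sqrt (T : Finset ι) (a b : ι → ℝ) :
    |∑ τ ∈ T, a τ * b τ| ≤ Real.sqrt (∑ τ ∈ T, a τ ^ 2) * Real.sqrt (∑ τ ∈ T, b τ ^ 2) := by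
  rw [← Real.sqrt_mul (sum_nonneg fun _ _ => sq_nonneg _)]
  exact Real.abs_le_sqrt (sum_mul_sq_le_sq_mul_sq T a b)

/-- **★★ THE COUPLING LEMMA** [folklore; the Hellinger testing inequality — idea-3's Sketch §10 `abs_sum_sub_sum_le_hellinger`, importable form].  For two laws
`p, q` on `T` (nonnegative, total mass one), ANY observable `f : ι → ℝ` and ANY centring constant `c`,
`|Σ_T q·f − Σ_T p·f| ≤ 2·√(2·(1 − Σ_T √(p·q)))·√(Σ_T ½(p+q)·(f − c)²)` — the difference of the two ONE-RUN expectations of a (one- or two-run) observable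
costs the HELLINGER functional of the pair times the observable's second moment under the MIXTURE `½(p+q)` of the two laws.  Used for the bootstrap (§1), and
in §4 to charge the cross term `(E_q − E_p)[j]` of the endpoint response identity to the V-side functional. -/
theorem abs_mean_sub_mean_le_hellinger (hp : ∀ τ ∈ T, 0 ≤ p τ) (hq : ∀ τ ∈ T, 0 ≤ q τ)
    (hp1 : ∑ τ ∈ T, p τ = 1) (hq1 : ∑ τ ∈ T, q τ = 1) (f : ι → ℝ) (c : ℝ) :
    |∑ τ ∈ T, q τ * f τ - ∑ τ ∈ T, p τ * f τ|
      ≤ 2 * Real.sqrt (2 * (1 - ∑ τ ∈ T, Real.sqrt (p τ * q τ)))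
          * Real.sqrt (∑ τ ∈ T, (p τ + q τ) / 2 * (f τ - c) ^ 2) := by
  have e0 : ∑ τ ∈ T, p τ * f τ - ∑ τ ∈ T, q τ * f τ
      = ∑ τ ∈ T, (Real.sqrt (p τ) - Real.sqrt (q τ)) * ((Real.sqrt (p τ) + Real.sqrt (q τ)) * (f τ - c)) := by
    have hc : ∑ τ ∈ T, (p τ - q τ) * c = 0 := by
      rw [← sum_mul, sum_sub_distrib, hp1, hq1, sub_self, zero_mul]
    calc ∑ τ ∈ T, p τ * f τ - ∑ τ ∈ T, q τ * f τ
        = ∑ τ ∈ T, (p τ - q τ) * (f τ - c) + ∑ τ ∈ T, (p τ - q τ) * c := by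
          rw [← sum_sub_distrib, ← sum_add_distrib]
          exact sum_congr rfl fun τ _ => by ring
      _ = ∑ τ ∈ T, (p τ - q τ) * (f τ - c) := by rw [hc, add_zero]
      _ = ∑ τ ∈ T, (Real.sqrt (p τ) - Real.sqrt (q τ)) * ((Real.sqrt (p τ) + Real.sqrt (q τ)) * (f τ - c)) := by
          refine sum_congr rfl fun τ hτ => ?_
          have hp2 := Real.sq_sqrt (hp τ hτ)
          have hq2 := Real.sq_sqrt (hq τ hτ)
          have hfac : p τ - q τ = (Real.sqrt (p τ) - Real.sqrt (q τ)) * (Real.sqrt (p τ) + Real.sqrt (q τ)) := by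
            linear_combination (-1 : ℝ) * hp2 + hq2
          rw [hfac]; ring
  have h1 : |∑ τ ∈ T, (Real.sqrt (p τ) - Real.sqrt (q τ)) * ((Real.sqrt (p τ) + Real.sqrt (q τ)) * (f τ - c))|
      ≤ Real.sqrt (∑ τ ∈ T, (Real.sqrt (p τ) - Real.sqrt (q τ)) ^ 2)
        * Real.sqrt (∑ τ ∈ T, ((Real.sqrt (p τ) + Real.sqrt (q τ)) * (f τ - c)) ^ 2) :=
    abs_sum_mul_le_sqrt_mul_sqrt T (fun τ => Real.sqrt (p τ) - Real.sqrt (q τ))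
      (fun τ => (Real.sqrt (p τ) + Real.sqrt (q τ)) * (f τ - c))
  have e1 : ∑ τ ∈ T, (Real.sqrt (p τ) - Real.sqrt (q τ)) ^ 2 = 2 * (1 - ∑ τ ∈ T, Real.sqrt (p τ * q τ)) := by
    rw [sum_sq_sqrt_sub_sqrt_eq T hp hq hp1 hq1]; ring
  have h3 : ∑ τ ∈ T, ((Real.sqrt (p τ) + Real.sqrt (q τ)) * (f τ - c)) ^ 2
      ≤ 2 ^ 2 * ∑ τ ∈ T, (p τ + q τ) / 2 * (f τ - c) ^ 2 := by
    rw [mul_sum]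
    refine sum_le_sum fun τ hτ => ?_
    have hsq : (Real.sqrt (p τ) + Real.sqrt (q τ)) ^ 2 ≤ 2 * (p τ + q τ) := by
      nlinarith [Real.sq_sqrt (hp τ hτ), Real.sq_sqrt (hq τ hτ), sq_nonneg (Real.sqrt (p τ) - Real.sqrt (q τ))]
    rw [mul_pow]
    nlinarith [sq_nonneg (f τ - c)]
  have h4 : Real.sqrt (∑ τ ∈ T, ((Real.sqrt (p τ) + Real.sqrt (q τ)) * (f τ - c)) ^ 2)
      ≤ 2 * Real.sqrt (∑ τ ∈ T, (p τ + q τ) / 2 * (f τ - c) ^ 2) := by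
    calc Real.sqrt (∑ τ ∈ T, ((Real.sqrt (p τ) + Real.sqrt (q τ)) * (f τ - c)) ^ 2)
        ≤ Real.sqrt (2 ^ 2 * ∑ τ ∈ T, (p τ + q τ) / 2 * (f τ - c) ^ 2) := Real.sqrt_le_sqrt h3
      _ = 2 * Real.sqrt (∑ τ ∈ T, (p τ + q τ) / 2 * (f τ - c) ^ 2) := by
          rw [Real.sqrt_mul (by norm_num), Real.sqrt_sq (by norm_num)]
  rw [abs_sub_comm, e0]
  rw [e1] at h1
  calc |∑ τ ∈ T, (Real.sqrt (p τ) - Real.sqrt (q τ)) * ((Real.sqrt (p τ) + Real.sqrt (q τ)) * (f τ - c))|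
      ≤ Real.sqrt (2 * (1 - ∑ τ ∈ T, Real.sqrt (p τ * q τ)))
          * Real.sqrt (∑ τ ∈ T, ((Real.sqrt (p τ) + Real.sqrt (q τ)) * (f τ - c)) ^ 2) := h1
    _ ≤ Real.sqrt (2 * (1 - ∑ τ ∈ T, Real.sqrt (p τ * q τ)))
          * (2 * Real.sqrt (∑ τ ∈ T, (p τ + q τ) / 2 * (f τ - c) ^ 2)) :=
        mul_le_mul_of_nonneg_left h4 (Real.sqrt_nonneg _)
    _ = 2 * Real.sqrt (2 * (1 - ∑ τ ∈ T, Real.sqrt (p τ * q τ)))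
          * Real.sqrt (∑ τ ∈ T, (p τ + q τ) / 2 * (f τ - c) ^ 2) := by ring

/-- Bias–variance [folklore]: for a law `p` (total mass one), `Σ_T p·(f − c)² = Σ_T p·(f − E_p f)² + (E_p f − c)²`. -/
theorem sum_mul_sq_sub_eq (hp1 : ∑ τ ∈ T, p τ = 1) (f : ι → ℝ) (c : ℝ) :
    ∑ τ ∈ T, p τ * (f τ - c) ^ 2
      = ∑ τ ∈ T, p τ * (f τ - ∑ σ ∈ T, p σ * f σ) ^ 2 + (∑ σ ∈ T, p σ * f σ - c) ^ 2 := by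
  set m := ∑ σ ∈ T, p σ * f σ with hm
  have e : ∀ τ, p τ * (f τ - c) ^ 2
      = p τ * (f τ - m) ^ 2 + 2 * (m - c) * (p τ * f τ) + ((m - c) ^ 2 - 2 * (m - c) * m) * p τ := by
    intro τ; ring
  rw [sum_congr rfl fun τ _ => e τ, sum_add_distrib, sum_add_distrib, ← mul_sum, ← mul_sum, hp1, ← hm]
  ring

/-- The mixture second moment is nonnegative [bookkeeping]. -/
theorem mixtureMoment_nonneg (hp : ∀ τ ∈ T, 0 ≤ p τ) (hq : ∀ τ ∈ T, 0 ≤ q τ) (f : ι → ℝ) (c : ℝ) :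
    0 ≤ ∑ τ ∈ T, (p τ + q τ) / 2 * (f τ - c) ^ 2 :=
  sum_nonneg fun τ hτ => mul_nonneg (div_nonneg (add_nonneg (hp τ hτ) (hq τ hτ)) (by norm_num)) (sq_nonneg _)

/-- **★★ THE MOMENT BOOTSTRAP** [folklore; idea-3's Sketch §10 `mixture_moment_le`, importable form].  For two laws `p, q`, an observable `f` and a centring `c`
BETWEEN THE TWO MEANS (`E_p f ≤ c ≤ E_q f` — for the two-run increment this is §3's Gibbs–Bogoliubov sandwich), the mixture second moment
`M = Σ_T ½(p+q)(f − c)²` obeys `M ≤ ½(Var_p f + Var_q f) + 8·(1 − Σ√(pq))·M`: bias–variance under each law, both bias terms `≤ (E_q f − E_p f)²`, and the width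
`E_q f − E_p f` is a coupling term (`abs_mean_sub_mean_le_hellinger`). -/
theorem mixtureMoment_le (hp : ∀ τ ∈ T, 0 ≤ p τ) (hq : ∀ τ ∈ T, 0 ≤ q τ)
    (hp1 : ∑ τ ∈ T, p τ = 1) (hq1 : ∑ τ ∈ T, q τ = 1) (f : ι → ℝ) {c : ℝ}
    (hlo : ∑ τ ∈ T, p τ * f τ ≤ c) (hhi : c ≤ ∑ τ ∈ T, q τ * f τ) :
    ∑ τ ∈ T, (p τ + q τ) / 2 * (f τ - c) ^ 2
      ≤ ((∑ τ ∈ T, p τ * (f τ - ∑ σ ∈ T, p σ * f σ) ^ 2) + ∑ τ ∈ T, q τ * (f τ - ∑ σ ∈ T, q σ * f σ) ^ 2) / 2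
        + 8 * (1 - ∑ τ ∈ T, Real.sqrt (p τ * q τ)) * ∑ τ ∈ T, (p τ + q τ) / 2 * (f τ - c) ^ 2 := by
  have hsplit : ∑ τ ∈ T, (p τ + q τ) / 2 * (f τ - c) ^ 2
      = (∑ τ ∈ T, p τ * (f τ - c) ^ 2 + ∑ τ ∈ T, q τ * (f τ - c) ^ 2) / 2 := by
    rw [← sum_add_distrib, sum_div]
    exact sum_congr rfl fun τ _ => by ring
  have ep := sum_mul_sq_sub_eq hp1 f c
  have eq' := sum_mul_sq_sub_eq hq1 f c
  have hW := abs_mean_sub_mean_le_hellinger hp hq hp1 hq1 f c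
  have hbc : 0 ≤ 1 - ∑ τ ∈ T, Real.sqrt (p τ * q τ) := by linarith [affinity_le_one T hp hq hp1 hq1]
  have hMnn := mixtureMoment_nonneg hp hq f c
  have hW2 : (∑ τ ∈ T, q τ * f τ - ∑ τ ∈ T, p τ * f τ) ^ 2
      ≤ 8 * (1 - ∑ τ ∈ T, Real.sqrt (p τ * q τ)) * ∑ τ ∈ T, (p τ + q τ) / 2 * (f τ - c) ^ 2 := by
    calc (∑ τ ∈ T, q τ * f τ - ∑ τ ∈ T, p τ * f τ) ^ 2
        = |∑ τ ∈ T, q τ * f τ - ∑ τ ∈ T, p τ * f τ| ^ 2 := (sq_abs _).symm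
      _ ≤ (2 * Real.sqrt (2 * (1 - ∑ τ ∈ T, Real.sqrt (p τ * q τ)))
            * Real.sqrt (∑ τ ∈ T, (p τ + q τ) / 2 * (f τ - c) ^ 2)) ^ 2 :=
          pow_le_pow_left₀ (abs_nonneg _) hW 2
      _ = 8 * (1 - ∑ τ ∈ T, Real.sqrt (p τ * q τ)) * ∑ τ ∈ T, (p τ + q τ) / 2 * (f τ - c) ^ 2 := by
          rw [mul_pow, mul_pow, Real.sq_sqrt (by linarith), Real.sq_sqrt hMnn]; ring
  have b1 : (∑ σ ∈ T, p σ * f σ - c) ^ 2 ≤ (∑ τ ∈ T, q τ * f τ - ∑ τ ∈ T, p τ * f τ) ^ 2 := by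
    nlinarith [mul_nonneg (sub_nonneg.mpr hhi) (add_nonneg (sub_nonneg.mpr (hlo.trans hhi)) (sub_nonneg.mpr hlo))]
  have b2 : (∑ σ ∈ T, q σ * f σ - c) ^ 2 ≤ (∑ τ ∈ T, q τ * f τ - ∑ τ ∈ T, p τ * f τ) ^ 2 := by
    nlinarith [mul_nonneg (sub_nonneg.mpr hlo) (add_nonneg (sub_nonneg.mpr hhi) (sub_nonneg.mpr (hlo.trans hhi)))]
  conv_lhs => rw [hsplit, ep, eq']
  linarith

/-- **★ … IN THE REGIME `1 − Σ√(pq) ≤ 1∕16`** [folklore; idea-3's `mixture_moment_le_of_regime`]: the mixture second moment is at most the SUM OF THE TWO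
ONE-RUN VARIANCES of `f`, `Σ_T ½(p+q)(f − c)² ≤ Var_p f + Var_q f`.  The regime is an a-priori closeness INPUT (displayed), not derived. -/
theorem mixtureMoment_le_of_regime (hp : ∀ τ ∈ T, 0 ≤ p τ) (hq : ∀ τ ∈ T, 0 ≤ q τ)
    (hp1 : ∑ τ ∈ T, p τ = 1) (hq1 : ∑ τ ∈ T, q τ = 1) (f : ι → ℝ) {c : ℝ}
    (hlo : ∑ τ ∈ T, p τ * f τ ≤ c) (hhi : c ≤ ∑ τ ∈ T, q τ * f τ)
    (hreg : 1 - ∑ τ ∈ T, Real.sqrt (p τ * q τ) ≤ 1 / 16) :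
    ∑ τ ∈ T, (p τ + q τ) / 2 * (f τ - c) ^ 2
      ≤ (∑ τ ∈ T, p τ * (f τ - ∑ σ ∈ T, p σ * f σ) ^ 2) + ∑ τ ∈ T, q τ * (f τ - ∑ σ ∈ T, q σ * f σ) ^ 2 := by
  have hM := mixtureMoment_le hp hq hp1 hq1 f hlo hhi
  have hMnn := mixtureMoment_nonneg hp hq f c
  nlinarith [mul_le_mul_of_nonneg_right hreg hMnn]

end Laws

/-! ## §2 The range-free V-side: Padé, triangular discrimination, and the wild∕tame split [folklore] -/

section VSide
variable {T : Finset ι} {p q : ι → ℝ}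

/-- [folklore] `(a − b)∕(a + b) ≤ (log a − log b)∕2` for `a ≥ b > 0` (i.e. `tanh(u∕2) ≤ u∕2`, `u = log(a∕b) ≥ 0`) — from the tree's `[1,1]`-Padé bound
`2(s−1)∕(s+1) ≤ log s` (`Literature.Dynamics.Contraction.two_mul_sub_one_div_add_one_le_log`, the artanh series' first term) at `s = a∕b`. -/
theorem sub_div_add_le_half_log {a b : ℝ} (ha : 0 < a) (hb : 0 < b) (hab : b ≤ a) :
    (a - b) / (a + b) ≤ (Real.log a - Real.log b) / 2 := by
  have hs : 1 ≤ a / b := by rwa [le_div_iff₀ hb, one_mul]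
  have h := two_mul_sub_one_div_add_one_le_log hs
  rw [← Real.log_div ha.ne' hb.ne']
  have e : 2 * (a / b - 1) / (a / b + 1) = 2 * ((a - b) / (a + b)) := by
    field_simp
  rw [e] at h
  linarith

/-- RANGE-FREE SECOND-ORDER TERM [folklore]: for `a, b > 0`, `(a − b)²∕(a + b) ≤ (a + b)·(log a − log b)²∕4` — a UNIVERSAL constant, no range `e^{2R}`
(contrast `Literature.…T4VarianceMatching` §8's field-level modulus). -/
theorem sub_sq_div_add_le_mul_log_sq {a b : ℝ} (ha : 0 < a) (hb : 0 < b) :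
    (a - b) ^ 2 / (a + b) ≤ (a + b) * (Real.log a - Real.log b) ^ 2 / 4 := by
  have hab : 0 < a + b := add_pos ha hb
  have key : |a - b| / (a + b) ≤ |Real.log a - Real.log b| / 2 := by
    rcases le_total b a with h | h
    · rw [abs_of_nonneg (by linarith), abs_of_nonneg (by linarith [Real.log_le_log hb h])]
      exact sub_div_add_le_half_log ha hb h
    · rw [abs_of_nonpos (by linarith), abs_of_nonpos (by linarith [Real.log_le_log ha h]), neg_sub, neg_sub, add_comm]
      exact sub_div_add_le_half_log hb ha h
  have k2 : (|a - b| / (a + b)) ^ 2 ≤ (|Real.log a - Real.log b| / 2) ^ 2 :=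
    pow_le_pow_left₀ (div_nonneg (abs_nonneg _) hab.le) key 2
  rw [div_pow, div_pow, sq_abs, sq_abs, div_le_iff₀ (pow_pos hab 2)] at k2
  rw [div_le_iff₀ hab]
  calc (a - b) ^ 2 ≤ (Real.log a - Real.log b) ^ 2 / 2 ^ 2 * (a + b) ^ 2 := k2
    _ = (a + b) * (Real.log a - Real.log b) ^ 2 / 4 * (a + b) := by ring

/-- [folklore] `(√a − √b)² ≤ (a − b)²∕(a + b)` for `a, b ≥ 0` (both sides vanish at `a = b = 0`, where the right side is Lean's `0∕0 = 0`). -/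
theorem sq_sqrt_sub_sqrt_le {a b : ℝ} (ha : 0 ≤ a) (hb : 0 ≤ b) :
    (Real.sqrt a - Real.sqrt b) ^ 2 ≤ (a - b) ^ 2 / (a + b) := by
  rcases (add_nonneg ha hb).eq_or_lt with h0 | hpos
  · have ha0 : a = 0 := by linarith
    have hb0 : b = 0 := by linarith
    subst ha0; subst hb0; simp
  · rw [le_div_iff₀ hpos]
    have h1 : a - b = (Real.sqrt a - Real.sqrt b) * (Real.sqrt a + Real.sqrt b) := by
      have ha' := Real.sq_sqrt ha
      have hb' := Real.sq_sqrt hb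
      linear_combination (-1 : ℝ) * ha' + hb'
    have h2 : a + b ≤ (Real.sqrt a + Real.sqrt b) ^ 2 := by
      nlinarith [Real.sq_sqrt ha, Real.sq_sqrt hb, Real.sqrt_nonneg a, Real.sqrt_nonneg b]
    calc (Real.sqrt a - Real.sqrt b) ^ 2 * (a + b)
        ≤ (Real.sqrt a - Real.sqrt b) ^ 2 * (Real.sqrt a + Real.sqrt b) ^ 2 :=
          mul_le_mul_of_nonneg_left h2 (sq_nonneg _)
      _ = (a - b) ^ 2 := by rw [h1]; ring

/-- **★ WILD MASS + TRIANGULAR DISCRIMINATION** [folklore; idea-3's Sketch §3 `one_sub_bc_le_wild_add_tame`]: for two laws and ANY set `W ⊆ T` of «wild» classes,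
`1 − Σ_T √(pq) ≤ ½·Σ_W (p + q) + ½·Σ_{T∖W} (p − q)²∕(p + q)` — wild classes cost their MASS and nothing more (no bad-class dial, no range assumption there);
the tame remainder is second order in the misfit with a universal constant. -/
theorem one_sub_affinity_le_wildMass_add_triangular [DecidableEq ι] (hp : ∀ τ ∈ T, 0 ≤ p τ) (hq : ∀ τ ∈ T, 0 ≤ q τ)
    (hp1 : ∑ τ ∈ T, p τ = 1) (hq1 : ∑ τ ∈ T, q τ = 1) {W : Finset ι} (hW : W ⊆ T) :
    1 - ∑ τ ∈ T, Real.sqrt (p τ * q τ)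
      ≤ (∑ τ ∈ W, (p τ + q τ)) / 2 + (∑ τ ∈ T \ W, (p τ - q τ) ^ 2 / (p τ + q τ)) / 2 := by
  have h := sum_sq_sqrt_sub_sqrt_eq T hp hq hp1 hq1
  have h2 : ∑ τ ∈ T, (Real.sqrt (p τ) - Real.sqrt (q τ)) ^ 2 ≤ ∑ τ ∈ T, (p τ - q τ) ^ 2 / (p τ + q τ) :=
    sum_le_sum fun τ hτ => sq_sqrt_sub_sqrt_le (hp τ hτ) (hq τ hτ)
  have hsplit : ∑ τ ∈ T \ W, (p τ - q τ) ^ 2 / (p τ + q τ) + ∑ τ ∈ W, (p τ - q τ) ^ 2 / (p τ + q τ)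
      = ∑ τ ∈ T, (p τ - q τ) ^ 2 / (p τ + q τ) := sum_sdiff hW
  have hWle : ∑ τ ∈ W, (p τ - q τ) ^ 2 / (p τ + q τ) ≤ ∑ τ ∈ W, (p τ + q τ) := by
    refine sum_le_sum fun τ hτ => ?_
    have hpτ := hp τ (hW hτ)
    have hqτ := hq τ (hW hτ)
    rcases (add_nonneg hpτ hqτ).eq_or_lt with h0 | hpos
    · rw [← h0]; simp
    · rw [div_le_iff₀ hpos]; nlinarith [mul_nonneg hpτ hqτ]
  linarith

/-- **★★ WILD MASS + MIXTURE LOG-MOMENT** [folklore; idea-3's Sketch §10 `one_sub_bc_le_wild_add_moment`, importable form]: for two laws, positive off a wild set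
`W ⊆ T`, `1 − Σ_T √(pq) ≤ ½·Σ_W (p + q) + ⅛·Σ_{T∖W} (p + q)(log p − log q)²` — tame classes cost the second moment of the log-ratio under the MIXTURE of the two
laws (times `¼`); no interpolated ensemble, no range constant. -/
theorem one_sub_affinity_le_wildMass_add_logMoment [DecidableEq ι] (hp : ∀ τ ∈ T, 0 ≤ p τ) (hq : ∀ τ ∈ T, 0 ≤ q τ)
    (hp1 : ∑ τ ∈ T, p τ = 1) (hq1 : ∑ τ ∈ T, q τ = 1) {W : Finset ι} (hW : W ⊆ T)
    (hp' : ∀ τ ∈ T \ W, 0 < p τ) (hq' : ∀ τ ∈ T \ W, 0 < q τ) :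
    1 - ∑ τ ∈ T, Real.sqrt (p τ * q τ)
      ≤ (∑ τ ∈ W, (p τ + q τ)) / 2
        + (∑ τ ∈ T \ W, (p τ + q τ) * (Real.log (p τ) - Real.log (q τ)) ^ 2) / 8 := by
  have h := one_sub_affinity_le_wildMass_add_triangular hp hq hp1 hq1 hW
  have h2 : ∑ τ ∈ T \ W, (p τ - q τ) ^ 2 / (p τ + q τ)
      ≤ ∑ τ ∈ T \ W, (p τ + q τ) * (Real.log (p τ) - Real.log (q τ)) ^ 2 / 4 :=
    sum_le_sum fun τ hτ => sub_sq_div_add_le_mul_log_sq (hp' τ hτ) (hq' τ hτ)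
  rw [← sum_div] at h2
  linarith

end VSide

/-! ## §3 Toy (A6): the hypothesis set is inhabited — identical laws [folklore] -/

section Toy
variable {T : Finset ι} {p : ι → ℝ}

/-- Identical laws have affinity one … -/
theorem affinity_self (hp : ∀ τ ∈ T, 0 ≤ p τ) (hp1 : ∑ τ ∈ T, p τ = 1) :
    ∑ τ ∈ T, Real.sqrt (p τ * p τ) = 1 := by
  rw [← hp1]
  exact sum_congr rfl fun τ hτ => Real.sqrt_mul_self (hp τ hτ)

/-- … so the coupling lemma's right side vanishes and the two «one-run» means agree (the bound is attained). -/
theorem toy_coupling_identical (hp : ∀ τ ∈ T, 0 ≤ p τ) (hp1 : ∑ τ ∈ T, p τ = 1) (f : ι → ℝ) (c : ℝ) :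
    |∑ τ ∈ T, p τ * f τ - ∑ τ ∈ T, p τ * f τ|
      ≤ 2 * Real.sqrt (2 * (1 - ∑ τ ∈ T, Real.sqrt (p τ * p τ)))
          * Real.sqrt (∑ τ ∈ T, (p τ + p τ) / 2 * (f τ - c) ^ 2) ∧
    2 * Real.sqrt (2 * (1 - ∑ τ ∈ T, Real.sqrt (p τ * p τ)))
          * Real.sqrt (∑ τ ∈ T, (p τ + p τ) / 2 * (f τ - c) ^ 2) = 0 := by
  refine ⟨abs_mean_sub_mean_le_hellinger hp hp hp1 hp1 f c, ?_⟩
  rw [affinity_self hp hp1, sub_self, mul_zero, Real.sqrt_zero, mul_zero, zero_mul]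

end Toy

end Summit.QuantumFields.YangMills.BalabanUVNodes.N20HellingerEndpointKernel
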